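import Literature.Analysis.FluidPDE.OnsagerBDSVPrincipalPartBound
import Literature.Analysis.FluidPDE.OnsagerBDSVCorrectorBoundsProofs
import HarnessLib

/-!
# The BDSV perturbation: proof of Cor. 5.8 (5.31) — the velocity increment bound `BDSV.incrementEstimate`

Buckmaster–De Lellis–Székelyhidi–Vicol (BDSV), *Onsager's conjecture for admissible weak
solutions*, Comm. Pure Appl. Math. **72** (2019) 229–274 = arXiv:1701.08678, Cor. 5.8:

> "Assuming `a` is sufficiently large, the perturbations `w_o`, `w_c` and `w_q` [sic] satisfy
> (5.29) `‖w_o‖₀ + λ_{q+1}⁻¹‖w_o‖₁ ≤ (M/4) δ_{q+1}^{1/2}`,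
> (5.30) `‖w_c‖₀ + λ_{q+1}⁻¹‖w_c‖₁ ≲ δ_{q+1}^{1/2} ℓ⁻¹ λ_{q+1}⁻¹`,
> (5.31) `‖w_{q+1}‖₀ + λ_{q+1}⁻¹‖w_{q+1}‖₁ ≤ (M/2) δ_{q+1}^{1/2}`,
> where the constant `M` depends solely on the constant `c₀` in (5.19)."

and its proof (arXiv (5.32)–(5.36)): `‖(∇Φ_i)⁻¹‖₀ ≤ 2` on `supp η_i` (Lemma 5.4), disjoint supports
of the `w_{o,i}`, Lemma 5.5 / Def. 5.6 for the Mikado profile, the chain rule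
`‖∇e^{iλ_{q+1}k·Φ_i}‖₀ ≤ 2λ_{q+1}|k|`, Prop. 5.7 for the slow factors, "(5.30) is a direct
consequence of (5.26) and (5.34)", and (6.6) `(ℓλ_{q+1})⁻¹ ≤ 1` — more precisely
`(ℓλ_{q+1})⁻¹ → 0` — for `b > (1-β+3α/2)/(1-β)` and `a` large, so that `w_c` and all the slow
terms are absorbed into `(M/4)δ_{q+1}^{1/2}`.

This file PROVES the named fact `BDSV.incrementEstimate` (F₄ of
`OnsagerBDSVPerturbation.lean`): `theorem incrementEstimate_holds`. The point, compared with the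
proved `BDSV.principalPartBound` (`OnsagerBDSVPrincipalPartBound.lean`, an existential constant
fixed after `C_in`), is the order of quantifiers printed in Cor. 5.8 and transcribed in
`BDSV.incrementEstimate`: the constant `M` is fixed right after the Mikado datum `𝔚` and `c₀`,
BEFORE `β, b, α`, the cut-off constants `C_η` and the input constants `C_in, C₀`. Following the
printed proof, the leading terms carry constants depending on `(𝔚, c₀)` only:

* `‖w_o‖₀ ≤ 27 K_W (δ_{q+1}/c₀)^{1/2}` and `‖∇w_o‖₀ ≤ 108 C_W n_{q+1} (δ_{q+1}/c₀)^{1/2} + (slow terms)`,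
  where `K_W`, `C_W` bound `W` and `D¹W` on the FIXED compact set `‖R‖_∞ ≤ 2` of matrices
  (Remark 5.2 / Lemma 5.5: it contains `B̄_{1/10}(Id) ∋ R̃_{q,i}` by Lemma 5.4,
  `BDSV.PerturbationData.tildeR_mem_closedBall`), and `‖∇Φ_i‖_∞ ≤ 301/300`, `‖adj∇Φ_i‖_∞ ≤ 3` on
  `supp η_i` once `exp(4C_inℓ^{2α}) - 1 ≤ 1/300` (Lemma 5.4 (5.14), `BDSV.exists_threshold_deformation`)
  — `BDSV.PerturbationData.norm_principalPart_le_sharp`, `BDSV.PerturbationData.norm_partialDeriv_principalPart_le_sharp`;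
* the slow terms `≲ δ_{q+1}^{1/2}(ℓ⁻¹ + 1)` (constants depending on `C_in`, `C_η(0,1)`, the
  constant of Prop. 5.7 (5.23) — the proved `BDSV.gradPhiBound_holds` — and `K_W, C_W`), and the
  corrector `‖w_c‖₀ ≤ Cδ_{q+1}^{1/2}ℓ⁻¹λ_{q+1}⁻¹`, `[w_c]₁ ≤ Cδ_{q+1}^{1/2}ℓ⁻¹` (the proved
  `BDSV.correctorPartBound_holds`), are absorbed using arXiv (6.4) `(ℓλ_{q+1})⁻¹ → 0`
  (`BDSV.exists_threshold_mollScale_freq_succ`) and `λ_{q+1}⁻¹ → 0`, `n_{q+1} ≤ λ_{q+1}`;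
* the result is (5.31) in the transcribed form `BDSV.VelocityIncrementBound (M/2)` with
  `M = 2(2K₀ + K₁ + 1)`, `K₀ = 27K_W/c₀^{1/2}`, `K₁ = 108C_W/c₀^{1/2}`.

With `BDSV.energyEstimate_holds` and (later) `BDSV.stressEstimate_holds` this feeds
`BDSV.perturbationStage_of_three` (`OnsagerBDSVPerturbationAssembly.lean`).

## References

* T. Buckmaster, C. De Lellis, L. Székelyhidi Jr., V. Vicol, *Onsager's conjecture for admissible
  weak solutions*, Comm. Pure Appl. Math. 72 (2019) 229–274 = arXiv:1701.08678, §5.5 Cor. 5.8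
  (arXiv (5.29)–(5.31)) and its proof (arXiv (5.32)–(5.36)); Def. 5.6; Lemma 5.4 (5.14); Prop. 5.7
  (5.23)–(5.24); Remark 5.2; §6.1.1 (6.4), (6.6). Equation numbers as in arXiv:1701.08678v1.
-/

open MeasureTheory Set
open scoped NNReal ENNReal ContDiff Matrix Matrix.Norms.Elementwise

noncomputable section

namespace Literature.Analysis.FluidPDE

namespace BDSV

open FunctionSpaces FunctionSpaces.Torus

/-! ## Thresholds in `a` -/

section Thresholds

/-- Two thresholds in `a` hold simultaneously beyond the larger one. [folklore] -/
theorem exists_threshold_and {P Q : ℝ → Prop}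
    (hP : ∃ a₁ : ℝ, 1 < a₁ ∧ ∀ a : ℝ, a₁ ≤ a → P a) (hQ : ∃ a₂ : ℝ, 1 < a₂ ∧ ∀ a : ℝ, a₂ ≤ a → Q a) :
    ∃ a₀ : ℝ, 1 < a₀ ∧ ∀ a : ℝ, a₀ ≤ a → P a ∧ Q a := by
  obtain ⟨a₁, ha₁, hP⟩ := hP
  obtain ⟨a₂, ha₂, hQ⟩ := hQ
  exact ⟨max a₁ a₂, lt_max_of_lt_left ha₁, fun a ha =>
    ⟨hP a ((le_max_left _ _).trans ha), hQ a ((le_max_right _ _).trans ha)⟩⟩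

/-- **`λ_{q+1}⁻¹ → 0`**: for `1 ≤ b` and every `K`, `K λ_{q+1}⁻¹ ≤ 1` for all `q` once `a` is
large (the `a`-exponent of `λ_{q+1}⁻¹` is `-b < 0`). [cite: BuckmasterEtAl2018, §2.6 (2.25)–(2.26)] -/
theorem exists_threshold_freq_succ_inv {b : ℝ} (hb : 1 ≤ b) (K : ℝ) :
    ∃ a₁ : ℝ, 1 < a₁ ∧ ∀ a : ℝ, a₁ ≤ a → ∀ q : ℕ, K * (freq a b (q + 1))⁻¹ ≤ 1 := by
  have hE : (0 : ℝ) + b * (-1) + b ^ 2 * 0 < 0 := by nlinarith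
  obtain ⟨a₁, ha₁, h⟩ := exists_freq_triple_le hb hE K
  refine ⟨a₁, ha₁, fun a ha q => ?_⟩
  have key := h a ha q
  rwa [Real.rpow_zero, Real.rpow_zero, one_mul, mul_one, Real.rpow_neg_one] at key

/-- **The absorption arithmetic of Cor. 5.8** (arXiv (5.35)–(5.36) and the use of (6.4), (6.6)):
with `u = λ_{q+1}⁻¹ ∈ [0,1]`, `n_{q+1} u ≤ 1`, if the sup and derivative bounds of `w_o`, `w_c` are
`K₀s + C s ℓ⁻¹ u` and `s(K₁ n + J ℓ⁻¹ + J') + C s ℓ⁻¹` (`s = δ_{q+1}^{1/2}`), and the thresholds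
`(3C + J) ℓ⁻¹ u ≤ 1/2`, `J' u ≤ 1/2` hold, then `B₀ + u(B₀ + B₁) ≤ (2K₀ + K₁ + 1) s`.
[cite: BuckmasterEtAl2018, Cor. 5.8 (proof, arXiv (5.35)–(5.36))] -/
theorem increment_absorb {s u ℓi n K₀ K₁ J J' C : ℝ} (hs : 0 ≤ s) (hu0 : 0 ≤ u) (hu1 : u ≤ 1)
    (hnu : n * u ≤ 1) (hK₀ : 0 ≤ K₀) (hK₁ : 0 ≤ K₁) (hC : 0 ≤ C) (hℓi : 0 ≤ ℓi)
    (h64 : (3 * C + J) * (ℓi * u) ≤ 1 / 2) (hJ' : J' * u ≤ 1 / 2) :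
    (K₀ * s + C * (s * ℓi * u)) +
        u * ((K₀ * s + C * (s * ℓi * u)) + (s * (K₁ * n + J * ℓi + J') + C * (s * ℓi))) ≤
      (2 * K₀ + K₁ + 1) * s := by
  have hB : K₀ + C * ℓi * u + u * K₀ + C * ℓi * u * u + K₁ * (n * u) + J * ℓi * u + J' * u +
      C * ℓi * u ≤ 2 * K₀ + K₁ + 1 := by
    nlinarith [mul_nonneg hK₀ (sub_nonneg.2 hu1),
      mul_nonneg (mul_nonneg (mul_nonneg hC hℓi) hu0) (sub_nonneg.2 hu1),
      mul_nonneg hK₁ (sub_nonneg.2 hnu)]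
  calc (K₀ * s + C * (s * ℓi * u)) +
        u * ((K₀ * s + C * (s * ℓi * u)) + (s * (K₁ * n + J * ℓi + J') + C * (s * ℓi)))
      = s * (K₀ + C * ℓi * u + u * K₀ + C * ℓi * u * u + K₁ * (n * u) + J * ℓi * u + J' * u +
          C * ℓi * u) := by ring
    _ ≤ s * (2 * K₀ + K₁ + 1) := mul_le_mul_of_nonneg_left hB hs
    _ = (2 * K₀ + K₁ + 1) * s := mul_comm _ _

end Thresholds

/-! ## Sharp pointwise bounds on `supp η_i`: constants depending on `(𝔚, c₀)` only -/

section Pointwise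

variable {P : Params} {S : Setting} {Nbar : ℕ} {Cin C₀ c₀ : ℝ} {Cη : ℕ → ℕ → ℝ}

/-- **`‖∇Φ_i‖_∞ ≤ 301/300` on the support of `η_i`** under the deformation threshold
`exp(4C_inℓ^{2α}) - 1 ≤ 1/300` (Lemma 5.4 (5.14): `‖∇Φ_i - Id‖₀ ≲ τ_q‖v̄_q‖₁ ≲ ℓ^{2α} ≪ 1`, BDSV:
"`‖∇Φ_i - Id‖₀ ≤ 1/2` for `t ∈ supp(η_i)`"). [cite: BuckmasterEtAl2018, Lemma 5.4 (5.14)] -/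
theorem PerturbationData.norm_gradPhi_le_of_deformation (H : PerturbationHypotheses P S Nbar Cin C₀)
    (𝒟 : PerturbationData P S c₀ Cη) (hCin : 0 ≤ Cin) (ha : 1 ≤ P.a)
    (hdef : Real.exp (4 * (Cin * mollScale P.β P.α P.a P.b S.q ^ (2 * P.α))) - 1 ≤ 1 / 300)
    {i : ℕ} {t : ℝ} (ht : t ∈ Icc 0 S.T) {x' : (UnitAddTorus (Fin 3))} (hη : 𝒟.cut.η i t x' ≠ 0) (x : (UnitAddTorus (Fin 3))) :
    ‖gradPhi 𝒟.D i t x‖ ≤ 301 / 300 := by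
  rw [Matrix.norm_le_iff (by norm_num)]
  intro a j
  have hD := 𝒟.abs_partialDeriv_D_le_of_eta_ne_zero H hCin ha ht hη x a j
  have h1 : |(1 : (Matrix (Fin 3) (Fin 3) ℝ)) a j| ≤ 1 := by
    rw [Matrix.one_apply]; split_ifs <;> simp
  rw [Real.norm_eq_abs, gradPhi_apply]
  calc |(1 : (Matrix (Fin 3) (Fin 3) ℝ)) a j + partialDeriv j (𝒟.D i t) x a|
      ≤ |(1 : (Matrix (Fin 3) (Fin 3) ℝ)) a j| + |partialDeriv j (𝒟.D i t) x a| := abs_add_le _ _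
    _ ≤ 1 + 1 / 300 := add_le_add h1 (hD.trans hdef)
    _ = 301 / 300 := by norm_num

/-- **`‖adj∇Φ_i‖_∞ ≤ 3` on the support of `η_i`** under the deformation threshold (BDSV, proof
of Cor. 5.8, first line: "`‖(∇Φ_i)⁻¹‖₀ ≤ 2` on `supp η_i`"; here `‖adj A‖_∞ ≤ 2‖A‖_∞²` and
`‖∇Φ_i‖_∞ ≤ 301/300`; `adj∇Φ_i = (∇Φ_i)⁻¹` as `det∇Φ_i = 1`). [cite: BuckmasterEtAl2018, Cor. 5.8 (proof, first line)] -/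
theorem PerturbationData.norm_adjugate_gradPhi_le_three (H : PerturbationHypotheses P S Nbar Cin C₀)
    (𝒟 : PerturbationData P S c₀ Cη) (hCin : 0 ≤ Cin) (ha : 1 ≤ P.a)
    (hdef : Real.exp (4 * (Cin * mollScale P.β P.α P.a P.b S.q ^ (2 * P.α))) - 1 ≤ 1 / 300)
    {i : ℕ} {t : ℝ} (ht : t ∈ Icc 0 S.T) {x' : (UnitAddTorus (Fin 3))} (hη : 𝒟.cut.η i t x' ≠ 0) (x : (UnitAddTorus (Fin 3))) :
    ‖(gradPhi 𝒟.D i t x).adjugate‖ ≤ 3 := by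
  have hG := 𝒟.norm_gradPhi_le_of_deformation H hCin ha hdef ht hη x
  refine (norm_adjugate_le _).trans ?_
  have h2 : ‖gradPhi 𝒟.D i t x‖ ^ 2 ≤ (301 / 300) ^ 2 := pow_le_pow_left₀ (norm_nonneg _) hG 2
  nlinarith [h2]

/-- **`R̃_{q,i} ∈ {‖R‖_∞ ≤ 2}` on the support of `η_i`** (Lemma 5.4, last assertion:
`R̃_{q,i} ∈ B̄_{1/10}(Id)`, `BDSV.PerturbationData.tildeR_mem_closedBall`, and `‖Id‖_∞ ≤ 1`): the
fixed compact set of matrices on which the Mikado profile is bounded (Remark 5.2).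
[cite: BuckmasterEtAl2018, Lemma 5.4 and Remark 5.2] -/
theorem PerturbationData.tildeR_mem_closedBall_zero (H : PerturbationHypotheses P S Nbar Cin C₀)
    (𝒟 : PerturbationData P S c₀ Cη) (hCin : 0 ≤ Cin) (ha : 1 ≤ P.a)
    (hdef : Real.exp (4 * (Cin * mollScale P.β P.α P.a P.b S.q ^ (2 * P.α))) - 1 ≤ 1 / 300)
    (hstr : 8 * (Cin * (freq P.a P.b S.q ^ P.α * mollScale P.β P.α P.a P.b S.q ^ P.α)) ≤ 1 / 100)
    (h4 : 4 * amp P.β P.a P.b (S.q + 2) ≤ amp P.β P.a P.b (S.q + 1) * freq P.a P.b S.q ^ (-P.α))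
    {i : ℕ} {t : ℝ} (ht : t ∈ Icc 0 S.T) {x' : (UnitAddTorus (Fin 3))} (hη : 𝒟.cut.η i t x' ≠ 0) (x : (UnitAddTorus (Fin 3))) :
    tildeR P S 𝒟.cut.η 𝒟.D i t x ∈ Metric.closedBall (0 : (Matrix (Fin 3) (Fin 3) ℝ)) 2 := by
  have h := 𝒟.tildeR_mem_closedBall H hCin ha hdef hstr h4 ht hη x
  rw [Metric.mem_closedBall, dist_eq_norm] at h
  rw [Metric.mem_closedBall, dist_zero_right]
  calc ‖tildeR P S 𝒟.cut.η 𝒟.D i t x‖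
      = ‖(tildeR P S 𝒟.cut.η 𝒟.D i t x - 1) + 1‖ := by rw [sub_add_cancel]
    _ ≤ ‖tildeR P S 𝒟.cut.η 𝒟.D i t x - 1‖ + ‖(1 : (Matrix (Fin 3) (Fin 3) ℝ))‖ := norm_add_le _ _
    _ ≤ mikadoRadius + 1 := add_le_add h norm_one_matrix_le
    _ ≤ 2 := by norm_num [mikadoRadius]

/-- **Sharp sup bound on the principal part** (arXiv (5.33): "`‖w_o‖₀ ≤ (M/8)δ_{q+1}^{1/2}`" with
`M` depending on `c₀` and the profile only): under the standing hypotheses with `C_in ≥ 0`,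
`c₀ > 0`, `a ≥ 1`, `4δ_{q+2} ≤ δ_{q+1}λ_q^{-α}`, the deformation threshold and the stress threshold
`8C_inλ_q^αℓ^α ≤ 1/100` of Lemma 5.4, if `‖W‖ ≤ K_W` on `{‖R‖_∞ ≤ 2} × T³` then
`‖w_o(t,x)‖ ≤ 27 K_W (δ_{q+1}/c₀)^{1/2}` on `[0,T] × T³` (`|ρ_{q,i}^{1/2}| ≤ (δ_{q+1}/c₀)^{1/2}`,
`‖adj∇Φ_i‖_∞ ≤ 3`, `‖Av‖ ≤ 9‖A‖_∞‖v‖`, at most one cut-off active at each point).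
[cite: BuckmasterEtAl2018, Cor. 5.8 (proof, arXiv (5.33))] -/
theorem PerturbationData.norm_principalPart_le_sharp (H : PerturbationHypotheses P S Nbar Cin C₀)
    (𝒟 : PerturbationData P S c₀ Cη) (𝔚 : MikadoDatum mikadoRadius) (hc₀ : 0 < c₀) (hCin : 0 ≤ Cin)
    (ha : 1 ≤ P.a)
    (hdef : Real.exp (4 * (Cin * mollScale P.β P.α P.a P.b S.q ^ (2 * P.α))) - 1 ≤ 1 / 300)
    (hstr : 8 * (Cin * (freq P.a P.b S.q ^ P.α * mollScale P.β P.α P.a P.b S.q ^ P.α)) ≤ 1 / 100)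
    (h4 : 4 * amp P.β P.a P.b (S.q + 2) ≤ amp P.β P.a P.b (S.q + 1) * freq P.a P.b S.q ^ (-P.α))
    {KW : ℝ} (hKW0 : 0 ≤ KW)
    (hKW : ∀ R ∈ Metric.closedBall (0 : (Matrix (Fin 3) (Fin 3) ℝ)) 2, ∀ ξ : (UnitAddTorus (Fin 3)), ‖𝔚.W R ξ‖ ≤ KW)
    {t : ℝ} (ht : t ∈ Icc 0 S.T) (x : (UnitAddTorus (Fin 3))) :
    ‖principalPart P S 𝔚 𝒟.cut.η 𝒟.D t x‖ ≤ 27 * KW * Real.sqrt (amp P.β P.a P.b (S.q + 1) / c₀) := by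
  set B : ℝ := 27 * KW * Real.sqrt (amp P.β P.a P.b (S.q + 1) / c₀) with hB
  have hB0 : 0 ≤ B := by positivity
  refine 𝒟.cut.norm_sum_le t x hB0 (fun i hi => by rw [sqrtRhoI, hi, zero_mul, zero_smul]) ?_ _
  intro i
  by_cases hη : 𝒟.cut.η i t x = 0
  · rw [sqrtRhoI, hη, zero_mul, zero_smul, norm_zero]
    exact hB0
  · rw [norm_smul, Real.norm_eq_abs]
    have h1 := 𝒟.abs_sqrtRhoI_le H hc₀ ha ht i x
    have hadj := 𝒟.norm_adjugate_gradPhi_le_three H hCin ha hdef ht hη x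
    have hRt := 𝒟.tildeR_mem_closedBall_zero H hCin ha hdef hstr h4 ht hη x
    have hWle := hKW _ hRt (P.freqNat (S.q + 1) • phiPoint 𝒟.D i t x)
    have h2 := norm_toEuclideanLin_le (gradPhi 𝒟.D i t x).adjugate
      (𝔚.W (tildeR P S 𝒟.cut.η 𝒟.D i t x) (P.freqNat (S.q + 1) • phiPoint 𝒟.D i t x))
    have h3 : 9 * ‖(gradPhi 𝒟.D i t x).adjugate‖ *
        ‖𝔚.W (tildeR P S 𝒟.cut.η 𝒟.D i t x) (P.freqNat (S.q + 1) • phiPoint 𝒟.D i t x)‖ ≤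
        9 * 3 * KW :=
      mul_le_mul (mul_le_mul_of_nonneg_left hadj (by norm_num)) hWle (norm_nonneg _) (by positivity)
    calc |sqrtRhoI P S 𝒟.cut.η i t x| *
          ‖Matrix.toEuclideanLin (gradPhi 𝒟.D i t x).adjugate
            (𝔚.W (tildeR P S 𝒟.cut.η 𝒟.D i t x) (P.freqNat (S.q + 1) • phiPoint 𝒟.D i t x))‖
        ≤ Real.sqrt (amp P.β P.a P.b (S.q + 1) / c₀) * (9 * 3 * KW) :=
          mul_le_mul h1 (h2.trans h3) (norm_nonneg _) (Real.sqrt_nonneg _)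
      _ = B := by rw [hB]; ring

/-- **The derivative of the Mikado factor, sharp form** (the chain rule (5.34)
"`‖∇e^{iλ_{q+1}k·Φ_i}‖₀ ≤ λ_{q+1}|k|‖∇Φ_i‖₀ ≤ 2λ_{q+1}|k|`" for the whole profile): if `‖D¹W‖ ≤ C_W`
on `B̄(0,ρ) × ℝ³` with `R̃_{q,i}(t,x) ∈ B̄(0,ρ)`, `‖∂ⱼR̃_{q,i}(t,x)‖ ≤ R₁`, and the deformation
threshold holds, then `‖∂ⱼ[W(R̃_{q,i}, n_{q+1}Φ_i)](t,x)‖ ≤ C_W (R₁ + 4n_{q+1})`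
(`‖eⱼ + ∂ⱼD_i‖ ≤ 3‖∇Φ_i‖_∞ ≤ 4`). [cite: BuckmasterEtAl2018, Cor. 5.8 (proof, arXiv (5.34))] -/
theorem PerturbationData.norm_partialDeriv_mikadoW_le_sharp (H : PerturbationHypotheses P S Nbar Cin C₀)
    (𝒟 : PerturbationData P S c₀ Cη) (𝔚 : MikadoDatum mikadoRadius) (hCin : 0 ≤ Cin) (ha : 1 ≤ P.a)
    (hdef : Real.exp (4 * (Cin * mollScale P.β P.α P.a P.b S.q ^ (2 * P.α))) - 1 ≤ 1 / 300)
    (hρ : ∀ s ∈ Icc 0 S.T, rhoQ P S s ≠ 0)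
    {i : ℕ} {t : ℝ} (ht : t ∈ Icc 0 S.T) {x' : (UnitAddTorus (Fin 3))} (hη : 𝒟.cut.η i t x' ≠ 0) {ρ CW R₁ : ℝ}
    (hCW0 : 0 ≤ CW)
    (hCW : ∀ R ∈ Metric.closedBall (0 : (Matrix (Fin 3) (Fin 3) ℝ)) ρ, ∀ ξ : (EuclideanSpace ℝ (Fin 3)), ‖iteratedFDeriv ℝ 1 (mikadoLift 𝔚.W) (R, ξ)‖ ≤ CW)
    {j : Fin 3} {x : (UnitAddTorus (Fin 3))} (hRt : tildeR P S 𝒟.cut.η 𝒟.D i t x ∈ Metric.closedBall (0 : (Matrix (Fin 3) (Fin 3) ℝ)) ρ)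
    (hR1 : ‖partialDeriv j (tildeR P S 𝒟.cut.η 𝒟.D i t) x‖ ≤ R₁) :
    ‖partialDeriv j (fun y => 𝔚.W (tildeR P S 𝒟.cut.η 𝒟.D i t y)
        (P.freqNat (S.q + 1) • phiPoint 𝒟.D i t y)) x‖ ≤
      CW * (R₁ + P.freqNat (S.q + 1) * 4) := by
  have hDt : IsSmooth (𝒟.D i t) := (𝒟.flow i).smooth.isSmooth_slice ht
  have hRm : IsSmooth (tildeR P S 𝒟.cut.η 𝒟.D i t) :=
    isSmooth_matrix_of_entries fun a b =>
      (isSmoothSpaceTimeOn_tildeR H.pos_T H.profile.smooth H.eulerReynolds.smooth_velocity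
        H.eulerReynolds.smooth_stress 𝒟.cut.smooth (fun k => (𝒟.flow k).smooth) hρ i a b).isSmooth_slice ht
  have h := norm_partialDeriv_mikado_comp_le (V := 𝔚.W) 𝔚.smooth_W hRm hDt (P.freqNat (S.q + 1))
    hCW0 (fun ξ => hCW _ hRt ξ) j
  have hG := 𝒟.norm_gradPhi_le_of_deformation H hCin ha hdef ht hη x
  have hG4 : 3 * ‖gradPhi 𝒟.D i t x‖ ≤ 4 := by linarith
  refine h.trans (mul_le_mul_of_nonneg_left (max_le ?_ ?_) hCW0)
  · exact hR1.trans (le_add_of_nonneg_right (by positivity))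
  · refine le_add_of_nonneg_of_le ((norm_nonneg _).trans hR1) ?_
    exact mul_le_mul_of_nonneg_left ((norm_single_add_partialDeriv_le 𝒟.D i t x j).trans hG4)
      (Nat.cast_nonneg _)

/-- **Sharp derivative bound on the principal part** (arXiv (5.35):
"`‖∇w_o‖₀ ≤ (M/16)δ_{q+1}^{1/2}λ_{q+1} + C̄δ_{q+1}^{1/2}ℓ⁻¹`, where `C̄` depends upon `α`, `β` and
`M`; observe that `M/16` bounds the zero-order part with no `ℓ`"): under the standing hypotheses
with `N̄ ≥ 1`, `C_in ≥ 0`, `c₀ > 0`, `a ≥ 1`, `4δ_{q+2} ≤ δ_{q+1}λ_q^{-α}` and the two thresholds of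
Lemma 5.4, given bounds `K_W` on `W` and `C_W` on `D¹W` over `{‖R‖_∞ ≤ 2}` and a common `C¹`
bound `B₁` on `∇Φ_i`, `(∇Φ_i)⁻¹` over `Ĩ_i` (Prop. 5.7 (5.23)), every first spatial derivative of
`w_o` is bounded on `[0,T] × T³` by
`(δ_{q+1}/c₀)^{1/2}[108 C_W n_{q+1} + (27C_W·9e^{4C_in}(2(1+8C_in)B₁ + 8C_ine^{4C_in}ℓ⁻¹) + 9B₁K_W + 27max(C_η(0,1),0)K_W)]`:
the coefficient of `n_{q+1}` depends on `(𝔚, c₀)` only. Proof: Leibniz and chain rules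
(`BDSV.norm_partialDeriv_smul_toEuclideanLin_le`), Lemma 5.3, Lemma 5.4, the derivative of
`R̃_{q,i}` (`BDSV.PerturbationData.norm_partialDeriv_tildeR_le`), at most one cut-off active at each
point and `∂ⱼw_{o,i} = 0` off `supp η_i`. [cite: BuckmasterEtAl2018, Cor. 5.8 (proof, arXiv (5.35))] -/
theorem PerturbationData.norm_partialDeriv_principalPart_le_sharp (H : PerturbationHypotheses P S Nbar Cin C₀)
    (𝒟 : PerturbationData P S c₀ Cη) (𝔚 : MikadoDatum mikadoRadius) (hN : 1 ≤ Nbar) (hc₀ : 0 < c₀)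
    (hCin : 0 ≤ Cin) (ha : 1 ≤ P.a) (hb : 1 ≤ P.b) (hβ : 0 ≤ P.β) (hα : 0 ≤ P.α)
    (h4 : 4 * amp P.β P.a P.b (S.q + 2) ≤ amp P.β P.a P.b (S.q + 1) * freq P.a P.b S.q ^ (-P.α))
    (hdef : Real.exp (4 * (Cin * mollScale P.β P.α P.a P.b S.q ^ (2 * P.α))) - 1 ≤ 1 / 300)
    (hstr : 8 * (Cin * (freq P.a P.b S.q ^ P.α * mollScale P.β P.α P.a P.b S.q ^ P.α)) ≤ 1 / 100)
    {KW CW B₁ : ℝ} (hKW0 : 0 ≤ KW)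
    (hKW : ∀ R ∈ Metric.closedBall (0 : (Matrix (Fin 3) (Fin 3) ℝ)) 2, ∀ ξ : (UnitAddTorus (Fin 3)), ‖𝔚.W R ξ‖ ≤ KW)
    (hCW0 : 0 ≤ CW)
    (hCW : ∀ R ∈ Metric.closedBall (0 : (Matrix (Fin 3) (Fin 3) ℝ)) 2, ∀ ξ : (EuclideanSpace ℝ (Fin 3)), ‖iteratedFDeriv ℝ 1 (mikadoLift 𝔚.W) (R, ξ)‖ ≤ CW)
    (hB₁ : 0 ≤ B₁)
    (hG1 : ∀ i, HolderSupOnLE (tildeInterval S.T (P.τ S.q) i) (fun s y => gradPhi 𝒟.D i s y) 1 0 B₁)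
    (hGinv : ∀ i, HolderSupOnLE (tildeInterval S.T (P.τ S.q) i)
      (fun s y => (gradPhi 𝒟.D i s y)⁻¹) 1 0 B₁)
    {t : ℝ} (ht : t ∈ Icc 0 S.T) (j : Fin 3) (x : (UnitAddTorus (Fin 3))) :
    ‖partialDeriv j (principalPart P S 𝔚 𝒟.cut.η 𝒟.D t) x‖ ≤
      Real.sqrt (amp P.β P.a P.b (S.q + 1) / c₀) *
        (108 * CW * P.freqNat (S.q + 1) +
          (27 * CW * (9 * Real.exp (4 * Cin) * (2 * (1 + 8 * Cin) * B₁ +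
              Real.exp (4 * Cin) * (8 * Cin * (mollScale P.β P.α P.a P.b S.q)⁻¹))) +
            9 * B₁ * KW + 27 * max (Cη 0 1) 0 * KW)) := by
  -- `ρ_q > 0`, smooth data, smooth factors of the summands at time `t`
  have hρpos : ∀ s ∈ Icc 0 S.T, 0 < rhoQ P S s := fun s hs =>
    lt_of_lt_of_le (div_pos (mul_pos (amp_pos ha _) (Real.rpow_pos_of_pos (freq_pos ha _) _))
      (by norm_num)) (H.le_rhoQ h4 hs)
  have hSD : SmoothData P S 𝒟.cut.η 𝒟.D := H.toSmoothData hc₀ 𝒟 hρpos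
  have hf : ∀ i, IsSmooth (sqrtRhoI P S 𝒟.cut.η i t) := fun i => (hSD.sqrtRhoI i).isSmooth_slice ht
  have hA : ∀ i, IsSmooth (fun y => (gradPhi 𝒟.D i t y).adjugate) := fun i =>
    isSmooth_adjugate_of_entries fun a b =>
      isSmooth_gradPhi_entry ((𝒟.flow i).smooth.isSmooth_slice ht) a b
  have hv : ∀ i, IsSmooth (fun y => 𝔚.W (tildeR P S 𝒟.cut.η 𝒟.D i t y)
      (P.freqNat (S.q + 1) • phiPoint 𝒟.D i t y)) := fun i => (hSD.mikadoW 𝔚 i).isSmooth_slice ht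
  have hs : ∀ i, IsSmooth (principalSummand P S 𝔚 𝒟.cut.η 𝒟.D i t) := fun i =>
    (hf i).smul' (isSmooth_toEuclideanLin (hA i) (hv i))
  -- the bound is nonnegative
  set B : ℝ := Real.sqrt (amp P.β P.a P.b (S.q + 1) / c₀) *
        (108 * CW * P.freqNat (S.q + 1) +
          (27 * CW * (9 * Real.exp (4 * Cin) * (2 * (1 + 8 * Cin) * B₁ +
              Real.exp (4 * Cin) * (8 * Cin * (mollScale P.β P.α P.a P.b S.q)⁻¹))) +
            9 * B₁ * KW + 27 * max (Cη 0 1) 0 * KW)) with hB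
  have hℓ : 0 < mollScale P.β P.α P.a P.b S.q := mollScale_pos ha _
  have hCη0 : 0 ≤ max (Cη 0 1) 0 := le_max_right _ _
  have hB0 : 0 ≤ B := by positivity
  -- vanishing of `∂ⱼ w_{o,i}` off `supp η_i`
  have hzero : ∀ i, 𝒟.cut.η i t x = 0 → partialDeriv j (principalSummand P S 𝔚 𝒟.cut.η 𝒟.D i t) x = 0 :=
    fun i hi => partialDeriv_smul_toEuclideanLin_eq_zero (hf i) (hA i) (hv i)
      (by rw [sqrtRhoI, hi, zero_mul]) (𝒟.partialDeriv_sqrtRhoI_eq_zero ht hi j)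
  have e : principalPart P S 𝔚 𝒟.cut.η 𝒟.D t = fun y =>
      ∑ i ∈ Finset.range (cutoffCount S.T (P.τ S.q)), principalSummand P S 𝔚 𝒟.cut.η 𝒟.D i t y := rfl
  rw [e, partialDeriv_finset_sum _ (fun i _ => (hs i).isContDiff (by simp)) j x]
  refine 𝒟.cut.norm_sum_le t x hB0 hzero (fun i => ?_) _
  by_cases hi : 𝒟.cut.η i t x = 0
  · rw [hzero i hi, norm_zero]
    exact hB0
  · -- the bounds on the three factors at `(t, x)`, where `η_i(t,x) ≠ 0`
    have hRt := 𝒟.tildeR_mem_closedBall_zero H hCin ha hdef hstr h4 ht hi x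
    have h1 := 𝒟.abs_sqrtRhoI_le H hc₀ ha ht i x
    have h2 := 𝒟.abs_partialDeriv_sqrtRhoI_le H hc₀ ha (i := i) ht j x
    have h3 := 𝒟.norm_adjugate_gradPhi_le_three H hCin ha hdef ht hi x
    have h4' := 𝒟.norm_partialDeriv_adjugate_gradPhi_le H ha ht hi hB₁ (hGinv i) j x
    have h5 : ‖𝔚.W (tildeR P S 𝒟.cut.η 𝒟.D i t x) (P.freqNat (S.q + 1) • phiPoint 𝒟.D i t x)‖ ≤ KW :=
      hKW _ hRt _
    have hR1 := 𝒟.norm_partialDeriv_tildeR_le H hN hCin ha hb hβ hα h4 ht hi hB₁ (hG1 i) j x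
    have h6 := 𝒟.norm_partialDeriv_mikadoW_le_sharp H 𝔚 hCin ha hdef (fun s hs => (hρpos s hs).ne')
      ht hi hCW0 hCW hRt hR1
    refine (norm_partialDeriv_smul_toEuclideanLin_le (hf i) (hA i) (hv i) (Real.sqrt_nonneg _)
      (mul_nonneg hCη0 (Real.sqrt_nonneg _)) (by norm_num) h1 h2 h3 h4' h5 h6).trans (le_of_eq ?_)
    rw [hB]
    ring

end Pointwise

/-! ## Proof of Cor. 5.8, arXiv (5.31) -/

section Discharge

/-- **BDSV Cor. 5.8, (5.31), holds** (`‖w_{q+1}‖₀ + λ_{q+1}⁻¹‖w_{q+1}‖₁ ≤ (M/2)δ_{q+1}^{1/2}` for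
`a` sufficiently large, "where the constant `M` depends solely on the constant `c₀`" — and on
the Mikado profile, Def. 5.6): the named fact `BDSV.incrementEstimate`, with
`M = 2(2K₀ + K₁ + 1)`, `K₀ = 27K_W/c₀^{1/2}`, `K₁ = 108C_W/c₀^{1/2}`, `K_W`, `C_W` the bounds of `W`,
`D¹W` on `{‖R‖_∞ ≤ 2} × T³`. Proof as printed: `w_{q+1} = w_o + w_c`; the sharp bounds
`BDSV.PerturbationData.norm_principalPart_le_sharp` / `…norm_partialDeriv_principalPart_le_sharp`
on `w_o` (Lemma 5.4, Prop. 5.7 (5.23) through the proved `BDSV.gradPhiBound_holds`, Lemma 5.3);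
(5.30) for `w_c` (the proved `BDSV.correctorPartBound_holds`); and the absorption of all slow
terms by arXiv (6.4) `(ℓλ_{q+1})⁻¹ → 0`, `λ_{q+1}⁻¹ → 0`, `n_{q+1} ≤ λ_{q+1}`
(`BDSV.increment_absorb`). Thresholds: `α < min(α₀(5.23), α₀(5.30), βb(b-1), (1-β)(b-1)/3)`,
`N̄ = max(N̄(5.23), N̄(5.30), 1)`, `a` beyond the thresholds of (5.23), (5.30),
`4δ_{q+2} ≤ δ_{q+1}λ_q^{-α}`, `exp(4C_inℓ^{2α}) - 1 ≤ 1/300`, `8C_inλ_q^αℓ^α ≤ 1/100`,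
`2(3C + J) ≤ ℓλ_{q+1}` and `2J' ≤ λ_{q+1}`. [cite: BuckmasterEtAl2018, Cor. 5.8 (5.31) and Def. 5.6] -/
theorem incrementEstimate_holds : incrementEstimate := by
  intro 𝔚 c₀ hc₀
  -- the universal constants: bounds of `W`, `D¹W` on the fixed ball `‖R‖_∞ ≤ 2`, and `c₀`
  obtain ⟨KW, hKW0, hKW⟩ := 𝔚.exists_bound_W (isCompact_closedBall (0 : (Matrix (Fin 3) (Fin 3) ℝ)) 2)
  obtain ⟨CW, hCW0, hCW⟩ := exists_forall_norm_iteratedFDeriv_mikadoLift_le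
    𝔚.contDiff_mikadoLift_W (isCompact_closedBall (0 : (Matrix (Fin 3) (Fin 3) ℝ)) 2) 1
  have hc0' : 0 < Real.sqrt c₀ := Real.sqrt_pos.2 hc₀
  set K₀ : ℝ := 27 * KW / Real.sqrt c₀ with hK₀
  set K₁ : ℝ := 108 * CW / Real.sqrt c₀ with hK₁
  have hK₀0 : 0 ≤ K₀ := by positivity
  have hK₁0 : 0 ≤ K₁ := by positivity
  refine ⟨2 * (2 * K₀ + K₁ + 1), by positivity, fun Cη β hβ hβ3 b hb1 hb2 => ?_⟩
  -- Prop. 5.7 (5.23) and Cor. 5.8 (5.30), proved in the tree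
  obtain ⟨αG, hαG, hG⟩ := gradPhiBound_holds c₀ hc₀ Cη β hβ hβ3 b hb1 hb2
  obtain ⟨αc, hαc, hc⟩ := correctorPartBound_holds 𝔚 c₀ hc₀ Cη β hβ hβ3 b hb1 hb2
  have hb0 : (0 : ℝ) < b := by linarith
  have hbm : (0 : ℝ) < b - 1 := by linarith
  have h1β : (0 : ℝ) < 1 - β := by linarith
  refine ⟨min (min αG αc) (min (β * b * (b - 1)) ((1 - β) * (b - 1) / 3)),
    lt_min (lt_min hαG hαc) (lt_min (by positivity) (by positivity)), fun α hα hαlt => ?_⟩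
  have hαG' : α < αG := lt_of_lt_of_le hαlt ((min_le_left _ _).trans (min_le_left _ _))
  have hαc' : α < αc := lt_of_lt_of_le hαlt ((min_le_left _ _).trans (min_le_right _ _))
  have hαb : α < 2 * β * b * (b - 1) := by
    have := lt_of_lt_of_le hαlt ((min_le_right _ _).trans (min_le_left _ _))
    nlinarith [mul_pos hβ hb0]
  have hα64 : 3 * α / 2 < (b - 1) * (1 - β) := by
    have := lt_of_lt_of_le hαlt ((min_le_right _ _).trans (min_le_right _ _))
    nlinarith [mul_pos h1β hbm]
  obtain ⟨NG, hG⟩ := hG α hα hαG' 1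
  obtain ⟨Nc, hc⟩ := hc α hα hαc'
  refine ⟨max NG (max Nc 1), fun Cin C₀ => ?_⟩
  set Cp : ℝ := max Cin 0 with hCp
  have hCp0 : 0 ≤ Cp := le_max_right _ _
  obtain ⟨C₁, aG, haG, hG⟩ := hG Cp C₀
  obtain ⟨Cc, ac, hac, hc⟩ := hc Cin C₀
  have hC₁p0 : 0 ≤ max C₁ 0 := le_max_right _ _
  have hCcp0 : 0 ≤ max Cc 0 := le_max_right _ _
  have hCη0 : 0 ≤ max (Cη 0 1) 0 := le_max_right _ _
  -- the slow constants `J` (coefficient of `δ^{1/2}ℓ⁻¹`) and `J'` (coefficient of `δ^{1/2}`)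
  set J : ℝ := (27 * CW * (9 * Real.exp (4 * Cp) * (2 * (1 + 8 * Cp) * max C₁ 0 +
      Real.exp (4 * Cp) * (8 * Cp))) + 9 * max C₁ 0 * KW) / Real.sqrt c₀ with hJ
  set J' : ℝ := 27 * max (Cη 0 1) 0 * KW / Real.sqrt c₀ with hJ'
  have hJ0 : 0 ≤ J := by positivity
  have hJ'0 : 0 ≤ J' := by positivity
  -- thresholds in `a`
  obtain ⟨a₀, ha₀, hall⟩ := exists_threshold_and ⟨aG, haG, hG⟩ (exists_threshold_and ⟨ac, hac, hc⟩
    (exists_threshold_and (exists_threshold_four_amp hb1 hαb)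
    (exists_threshold_and (exists_threshold_deformation (b := b) hβ.le hb1.le hα hCp0)
    (exists_threshold_and (exists_threshold_freq_mul_mollScale_rpow_le hβ.le hb1.le hα (8 * Cp)
      (by norm_num : (0 : ℝ) < 1 / 100))
    (exists_threshold_and (exists_threshold_mollScale_freq_succ (β := β) hb1.le hα64 (2 * (3 * max Cc 0 + J)))
      (exists_threshold_freq_succ_inv hb1.le (2 * J')))))))
  refine ⟨a₀, ha₀, fun a ha S H 𝒟 => ?_⟩
  obtain ⟨hGa, hca, h4a, hdefa, hstra, h64a, hJ'a⟩ := hall a ha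
  have ha1 : (1 : ℝ) ≤ a := ha₀.le.trans ha
  -- the standing hypotheses at the orders and constants used
  have HG : PerturbationHypotheses ⟨β, α, a, b⟩ S NG Cp C₀ :=
    (H.of_le (le_max_left _ _)).mono_const ha1 (le_max_left _ _)
  have Hc : PerturbationHypotheses ⟨β, α, a, b⟩ S Nc Cin C₀ :=
    H.of_le ((le_max_left _ _).trans (le_max_right _ _))
  have H1 : PerturbationHypotheses ⟨β, α, a, b⟩ S 1 Cp C₀ :=
    (H.of_le ((le_max_right _ _).trans (le_max_right _ _))).mono_const ha1 (le_max_left _ _)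
  -- the parameter inequalities at this `a`
  have h4q : 4 * amp β a b (S.q + 2) ≤ amp β a b (S.q + 1) * freq a b S.q ^ (-α) := h4a S.q
  have hdef : Real.exp (4 * (Cp * mollScale β α a b S.q ^ (2 * α))) - 1 ≤ 1 / 300 := hdefa S.q
  have hstr : 8 * (Cp * (freq a b S.q ^ α * mollScale β α a b S.q ^ α)) ≤ 1 / 100 := by
    have h := hstra S.q
    rwa [mul_assoc] at h
  -- scales
  have hℓ : 0 < mollScale β α a b S.q := mollScale_pos ha1 _
  have hf1 : 0 < freq a b (S.q + 1) := freq_pos ha1 _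
  have h1f : 1 ≤ freq a b (S.q + 1) := one_le_freq ha1 _
  have hs0 : 0 ≤ Real.sqrt (amp β a b (S.q + 1)) := Real.sqrt_nonneg _
  have hσ : Real.sqrt (amp β a b (S.q + 1) / c₀) = Real.sqrt (amp β a b (S.q + 1)) / Real.sqrt c₀ :=
    Real.sqrt_div (amp_pos ha1 _).le c₀
  have hn : (Params.freqNat ⟨β, α, a, b⟩ (S.q + 1) : ℝ) ≤ freq a b (S.q + 1) :=
    Params.freqNat_le_freq ⟨β, α, a, b⟩ (by show (0 : ℝ) ≤ a; linarith) (S.q + 1)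
  have hn0 : (0 : ℝ) ≤ (Params.freqNat ⟨β, α, a, b⟩ (S.q + 1) : ℝ) := Nat.cast_nonneg _
  -- (5.23) at `N = 1`, with the constant `max C₁ 0 · ℓ⁻¹`
  have hmono : C₁ * mollScale β α a b S.q ^ (-((1 : ℕ) : ℝ)) ≤ max C₁ 0 * (mollScale β α a b S.q)⁻¹ := by
    rw [Nat.cast_one, Real.rpow_neg_one]
    exact mul_le_mul_of_nonneg_right (le_max_left _ _) (inv_nonneg.2 hℓ.le)
  have hG1 : ∀ i, HolderSupOnLE (tildeInterval S.T (Params.τ ⟨β, α, a, b⟩ S.q) i)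
      (fun s y => gradPhi 𝒟.D i s y) 1 0 (max C₁ 0 * (mollScale β α a b S.q)⁻¹) :=
    fun i => (hGa S HG 𝒟 i).1.mono hmono
  have hGinv : ∀ i, HolderSupOnLE (tildeInterval S.T (Params.τ ⟨β, α, a, b⟩ S.q) i)
      (fun s y => (gradPhi 𝒟.D i s y)⁻¹) 1 0 (max C₁ 0 * (mollScale β α a b S.q)⁻¹) :=
    fun i => (hGa S HG 𝒟 i).2.mono hmono
  have hB₁ : 0 ≤ max C₁ 0 * (mollScale β α a b S.q)⁻¹ := mul_nonneg hC₁p0 (inv_nonneg.2 hℓ.le)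
  -- the bounds on `w_o`
  have hsup_o : SupLE S.T (principalPart ⟨β, α, a, b⟩ S 𝔚 𝒟.cut.η 𝒟.D)
      (K₀ * Real.sqrt (amp β a b (S.q + 1))) := by
    intro t ht x
    have h := 𝒟.norm_principalPart_le_sharp H1 𝔚 hc₀ hCp0 ha1 hdef hstr h4q hKW0 hKW ht x
    rw [hσ] at h
    refine h.trans (le_of_eq ?_)
    rw [hK₀]
    ring
  have hder_o : DerivSupLE S.T (principalPart ⟨β, α, a, b⟩ S 𝔚 𝒟.cut.η 𝒟.D)
      (Real.sqrt (amp β a b (S.q + 1)) * (K₁ * (Params.freqNat ⟨β, α, a, b⟩ (S.q + 1) : ℝ) +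
        J * (mollScale β α a b S.q)⁻¹ + J')) := by
    intro j t ht x
    have h := 𝒟.norm_partialDeriv_principalPart_le_sharp H1 𝔚 le_rfl hc₀ hCp0 ha1 hb1.le hβ.le hα.le
      h4q hdef hstr hKW0 hKW hCW0 hCW hB₁ hG1 hGinv ht j x
    rw [hσ] at h
    refine h.trans (le_of_eq ?_)
    rw [hK₁, hJ, hJ']
    field_simp
    ring
  -- the bounds on `w_c` (5.30)
  have hsup_c : SupLE S.T (correctorPart ⟨β, α, a, b⟩ S 𝔚 𝒟.cut.η 𝒟.D)
      (max Cc 0 * (Real.sqrt (amp β a b (S.q + 1)) * (mollScale β α a b S.q)⁻¹ *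
        (freq a b (S.q + 1))⁻¹)) :=
    (hca S Hc 𝒟).1.mono (mul_le_mul_of_nonneg_right (le_max_left _ _)
      (mul_nonneg (mul_nonneg hs0 (inv_nonneg.2 hℓ.le)) (inv_nonneg.2 hf1.le)))
  have hder_c : DerivSupLE S.T (correctorPart ⟨β, α, a, b⟩ S 𝔚 𝒟.cut.η 𝒟.D)
      (max Cc 0 * (Real.sqrt (amp β a b (S.q + 1)) * (mollScale β α a b S.q)⁻¹)) :=
    (hca S Hc 𝒟).2.mono (mul_le_mul_of_nonneg_right (le_max_left _ _)
      (mul_nonneg hs0 (inv_nonneg.2 hℓ.le)))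
  -- smoothness of the two parts (for `∂ⱼ(w_o + w_c) = ∂ⱼw_o + ∂ⱼw_c`)
  have hρpos : ∀ s ∈ Icc 0 S.T, 0 < rhoQ ⟨β, α, a, b⟩ S s := fun s hs =>
    lt_of_lt_of_le (div_pos (mul_pos (amp_pos ha1 _) (Real.rpow_pos_of_pos (freq_pos ha1 _) _))
      (by norm_num)) (H1.le_rhoQ h4q hs)
  have hSD : SmoothData ⟨β, α, a, b⟩ S 𝒟.cut.η 𝒟.D := H1.toSmoothData hc₀ 𝒟 hρpos
  -- assembly of (5.31)
  refine ⟨K₀ * Real.sqrt (amp β a b (S.q + 1)) +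
      max Cc 0 * (Real.sqrt (amp β a b (S.q + 1)) * (mollScale β α a b S.q)⁻¹ * (freq a b (S.q + 1))⁻¹),
    Real.sqrt (amp β a b (S.q + 1)) * (K₁ * (Params.freqNat ⟨β, α, a, b⟩ (S.q + 1) : ℝ) +
        J * (mollScale β α a b S.q)⁻¹ + J') +
      max Cc 0 * (Real.sqrt (amp β a b (S.q + 1)) * (mollScale β α a b S.q)⁻¹), ?_, ?_, ?_⟩
  · -- `‖w_{q+1}‖₀ ≤ ‖w_o‖₀ + ‖w_c‖₀`
    intro t ht x
    rw [perturbation_eq_principalPart_add_correctorPart]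
    exact (norm_add_le _ _).trans (add_le_add (hsup_o t ht x) (hsup_c t ht x))
  · -- `[w_{q+1}]₁ ≤ [w_o]₁ + [w_c]₁`
    intro j t ht x
    have ho : IsSmooth (principalPart ⟨β, α, a, b⟩ S 𝔚 𝒟.cut.η 𝒟.D t) :=
      (hSD.principalPart 𝔚).isSmooth_slice ht
    have hw : IsSmooth (correctorPart ⟨β, α, a, b⟩ S 𝔚 𝒟.cut.η 𝒟.D t) :=
      (hSD.correctorPart 𝔚).isSmooth_slice ht
    have hfun : perturbation ⟨β, α, a, b⟩ S 𝔚 𝒟.cut.η 𝒟.D t =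
        principalPart ⟨β, α, a, b⟩ S 𝔚 𝒟.cut.η 𝒟.D t + correctorPart ⟨β, α, a, b⟩ S 𝔚 𝒟.cut.η 𝒟.D t := by
      funext y
      rw [Pi.add_apply]
      exact perturbation_eq_principalPart_add_correctorPart _ _ _ _ _ _ _
    rw [hfun, partialDeriv_add (ho.isContDiff (by simp)) (hw.isContDiff (by simp)) j, Pi.add_apply]
    exact (norm_add_le _ _).trans (add_le_add (hder_o j t ht x) (hder_c j t ht x))
  · -- the absorption of the slow terms
    have h64 : (3 * max Cc 0 + J) * ((mollScale β α a b S.q)⁻¹ * (freq a b (S.q + 1))⁻¹) ≤ 1 / 2 := by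
      have h := h64a S.q
      have hpos : 0 < mollScale β α a b S.q * freq a b (S.q + 1) := mul_pos hℓ hf1
      rw [← mul_inv, ← div_eq_mul_inv, le_div_iff₀ (by norm_num : (0 : ℝ) < 2)]
      rw [div_mul_eq_mul_div, div_le_iff₀ hpos]
      linarith
    have hJ'u : J' * (freq a b (S.q + 1))⁻¹ ≤ 1 / 2 := by
      have h := hJ'a S.q
      rw [← div_eq_mul_inv, div_le_iff₀ hf1] at h ⊢
      linarith
    have hu1 : (freq a b (S.q + 1))⁻¹ ≤ 1 := inv_le_one_of_one_le₀ h1f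
    have hnu : (Params.freqNat ⟨β, α, a, b⟩ (S.q + 1) : ℝ) * (freq a b (S.q + 1))⁻¹ ≤ 1 := by
      rw [← div_eq_mul_inv, div_le_one hf1]
      exact hn
    calc _ ≤ (2 * K₀ + K₁ + 1) * Real.sqrt (amp β a b (S.q + 1)) :=
          increment_absorb hs0 (inv_nonneg.2 hf1.le) hu1 hnu hK₀0 hK₁0 hCcp0 (inv_nonneg.2 hℓ.le) h64 hJ'u
      _ = 2 * (2 * K₀ + K₁ + 1) / 2 * Real.sqrt (amp β a b (S.q + 1)) := by ring

end Discharge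

end BDSV

end Literature.Analysis.FluidPDE
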